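import Literature.MathematicalPhysics.QuantumFieldTheory.Federbush1986.LatticeGaugeFunction

/-!
# `Federbush1986.SmoothGaugeInterpolation` — [Federbush1986PhaseCellI] §4 p. 329, (4.5)–(4.6): a smooth function `Λ` on `ℝ⁴`
# interpolating the lattice gauge function, `Λ = h` on `ℤ⁴`, with `|D^αΛ(x)| < c_α e^{−γ|x|}` — PROVED («as is trivial to
# accomplish»: a sum of disjoint translated bump functions)

statement-level skeleton of published theorems with citation tags; proofs where landed; nothing here is a claim about the Yang–Mills mass gap

CITATION HEADER.  P. Federbush, *A phase cell approach to Yang–Mills theory. I*, Commun. Math. Phys. **107** (1986) 319–329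
[Federbush1986PhaseCellI], §4 p. 329 (render `run/shared/lean/pub/lit-balaban/lit-balaban-r17/renders/fedI/fed1986-cmp107-
p011-x2.png`, re-read as an image), verbatim: *«We deduce |h(x)| < ce^{−γ|x|}. (4.4)  We now find Λ(x) in C^∞(R⁴) satisfying
Λ(x) = h(x), x ∈ Z⁴, (4.5) and |D^αΛ(x)| < c_αe^{−γ|x|}, (4.6) as is trivial to accomplish.  We let this be the Λ(x) of (3.2).»*
Unit `lit-balaban-p04` gen 6; SKELETON row **F1.Eq4.1-4.6** of `run/shared/lean/pub/lit-balaban/lit-balaban-r17/SKELETON-r17.md`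
(fold owner r17); companion `LatticeGaugeFunction` ((4.3)–(4.4): the lattice function `h` with `|h(x)| ≤ c'e^{−γ'|x|}`).

THE MATHEMATICS («trivial to accomplish», made explicit).  Fix a smooth bump `φ` on `ℝ⁴` with `φ = 1` near `0` and
`supp φ ⊆ B(0, 1/4)` (`bump`: Mathlib's `ContDiffBump (0 : ℝ⁴)` with radii `1/8 < 1/4`).  For a lattice function `h` with
`|h(n)| ≤ ce^{−γ|n|}` (`γ ≥ 0`) put `Λ(y) := Σ_{n∈ℤ⁴} h(n) φ(y − n)` (`interp`).  Distinct lattice points are at distance `≥ 1`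
(`one_le_norm_latPt_sub`), so for every `y` AT MOST ONE term is non-zero, and on the ball `B(n₀, 1/2)` resp. (when `y` is at
distance `≥ 1/2` from the lattice) on `B(y, 1/4)` the sum IS the single smooth term `h(n₀)φ(· − n₀)` resp. `0`
(`interp_eventuallyEq_near`, `interp_eventuallyEq_zero`).  Hence `Λ ∈ C^∞` (`contDiff_interp`), `Λ(n) = h(n)φ(0) = h(n)`
(**(4.5)**, `interp_latPt`), and `D^kΛ(y) = h(n₀)·(D^kφ)(y − n₀)` or `0`, so with `M_k = sup‖D^kφ‖` (finite: continuous with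
compact support) and `|n₀| ≥ |y| − 1/2`: `‖D^kΛ(y)‖ ≤ c e^{γ/2} M_k e^{−γ|y|}` — **(4.6)** with `c_k = ce^{γ/2}M_k` and the SAME
`γ` (`norm_iteratedFDeriv_interp_le`, `exists_smooth_interpolation`).  Combined with `LatticeGauge.exists_gaugeFn`
((4.3)–(4.4)) this gives the `Λ` of (3.2) for any decaying bond function with zero plaquette values
(`exists_smooth_gauge_of_decay`).

WHAT THIS MODULE PROVIDES.  Defs `latPt` (the point `n ∈ ℤ⁴ ⊂ ℝ⁴`), `bump`, `interp` (bodies); `latPt_sub`,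
`one_le_norm_latPt_sub`, `bump_eq_zero_of_le`, `interp_eq_near`, `interp_eq_zero_of_far`, `interp_eventuallyEq_near`,
`interp_eventuallyEq_zero`, **`contDiff_interp`**, **`interp_latPt`** ((4.5)), `exists_bound_iteratedFDeriv_bump`,
**`norm_iteratedFDeriv_interp_le`** ((4.6)), **`exists_smooth_interpolation`**, `exists_smooth_gauge_of_decay`.  No new `Prop`
fact; axioms standard.  **v1.1** (p04 gen 6, append-only): §4 `decayBound_of_support` — (4.2) «Clearly |A(e)| < ce^{−γd(e,0)}.
(A(e) is zero almost everywhere.)» for level-0 data vanishing beyond distance `c₀` and bounded by `|A(m)|` (READING `≤`).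
-/

namespace Literature.MathematicalPhysics.QuantumFieldTheory.Federbush1986

open Filter Set Metric
open scoped ContDiff

noncomputable section

namespace LatticeGauge

/-! ## §1 Lattice points are `1`-separated -/

/-- The lattice point `n ∈ ℤ⁴ ⊂ ℝ⁴` (the base vertex of any level-0 edge at `n`). [cite: Federbush1986PhaseCellI, §4 p. 329
(«x ∈ Z⁴»)] -/
abbrev latPt (x : Fin 4 → ℤ) : E4 := (⟨x, 0⟩ : Edge 0).src

/-- `latPt` is additive. [cite: Federbush1986PhaseCellI, §4 p. 329] -/
theorem latPt_sub (x y : Fin 4 → ℤ) : latPt x - latPt y = latPt (x - y) := by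
  ext k
  simp [latPt, Edge.src, mkPt, latLen]

/-- Distinct lattice points are at distance at least `1`. [cite: Federbush1986PhaseCellI, §4 p. 329] -/
theorem one_le_norm_latPt_sub {x y : Fin 4 → ℤ} (hxy : x ≠ y) : 1 ≤ ‖latPt x - latPt y‖ := by
  obtain ⟨k, hk⟩ := Function.ne_iff.1 hxy
  rw [latPt_sub]
  have h1 := abs_cast_le_norm_src (x - y) 0 k
  have h2 : (1 : ℝ) ≤ |((x - y) k : ℝ)| := by
    have : (1 : ℤ) ≤ |x k - y k| := Int.one_le_abs (sub_ne_zero.2 hk)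
    rw [Pi.sub_apply, ← Int.cast_abs]
    exact_mod_cast this
  exact h2.trans h1

/-! ## §2 The bump and the interpolant -/

/-- A smooth bump on `ℝ⁴`: `= 1` on `B(0, 1/8)`, supported in `B(0, 1/4)`. [cite: Federbush1986PhaseCellI, §4 (4.5)–(4.6)
p. 329 («as is trivial to accomplish»)] -/
def bump : ContDiffBump (0 : E4) := ⟨1 / 8, 1 / 4, by norm_num, by norm_num⟩

/-- The bump vanishes at distance `≥ 1/4` from the origin. [cite: Federbush1986PhaseCellI, §4 p. 329] -/
theorem bump_eq_zero_of_le {z : E4} (hz : 1 / 4 ≤ ‖z‖) : (bump : E4 → ℝ) z = 0 :=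
  bump.zero_of_le_dist (by rwa [dist_zero_right])

/-- **(4.5), the interpolant** `Λ(y) = Σ_{n∈ℤ⁴} h(n) φ(y − n)` (at most one non-zero term at each `y`).
[cite: Federbush1986PhaseCellI, (4.5) p. 329] -/
def interp (h : (Fin 4 → ℤ) → ℝ) (y : E4) : ℝ := ∑' n : Fin 4 → ℤ, h n • (bump : E4 → ℝ) (y - latPt n)

/-- Near a lattice point `n₀` (`|y − n₀| < 1/2`) every other term vanishes. [cite: Federbush1986PhaseCellI, (4.5) p. 329] -/
theorem term_eq_zero_of_ne (h : (Fin 4 → ℤ) → ℝ) {y : E4} {n₀ : Fin 4 → ℤ} (hy : ‖y - latPt n₀‖ < 1 / 2)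
    {n : Fin 4 → ℤ} (hn : n ≠ n₀) : h n • (bump : E4 → ℝ) (y - latPt n) = 0 := by
  have hsep := one_le_norm_latPt_sub hn.symm
  have htri : ‖latPt n₀ - latPt n‖ ≤ ‖y - latPt n₀‖ + ‖y - latPt n‖ := by
    have := norm_sub_le_norm_sub_add_norm_sub (latPt n₀) y (latPt n)
    rwa [norm_sub_rev (latPt n₀) y] at this
  rw [bump_eq_zero_of_le (by linarith), smul_zero]

/-- Near a lattice point the interpolant is the single term `h(n₀)φ(y − n₀)`. [cite: Federbush1986PhaseCellI, (4.5) p. 329] -/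
theorem interp_eq_near (h : (Fin 4 → ℤ) → ℝ) {y : E4} {n₀ : Fin 4 → ℤ} (hy : ‖y - latPt n₀‖ < 1 / 2) :
    interp h y = h n₀ • (bump : E4 → ℝ) (y - latPt n₀) :=
  tsum_eq_single n₀ fun _ hn => term_eq_zero_of_ne h hy hn

/-- Away from the lattice (`|y − n| ≥ 1/4` for all `n`) the interpolant vanishes. [cite: Federbush1986PhaseCellI, (4.5) p. 329] -/
theorem interp_eq_zero_of_far (h : (Fin 4 → ℤ) → ℝ) {y : E4} (hy : ∀ n, 1 / 4 ≤ ‖y - latPt n‖) : interp h y = 0 := by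
  have hz : ∀ m : Fin 4 → ℤ, h m • (bump : E4 → ℝ) (y - latPt m) = 0 := fun m => by
    rw [bump_eq_zero_of_le (hy m), smul_zero]
  unfold interp
  simp_rw [hz, tsum_zero]

/-- Local form near a lattice point: on `B(n₀, 1/2)` the interpolant is `h(n₀)φ(· − n₀)`. [cite: Federbush1986PhaseCellI,
(4.5) p. 329] -/
theorem interp_eventuallyEq_near (h : (Fin 4 → ℤ) → ℝ) {y : E4} {n₀ : Fin 4 → ℤ} (hy : ‖y - latPt n₀‖ < 1 / 2) :
    interp h =ᶠ[nhds y] fun y' => h n₀ • (bump : E4 → ℝ) (y' - latPt n₀) := by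
  have hmem : ball (latPt n₀) (1 / 2) ∈ nhds y := isOpen_ball.mem_nhds (by rwa [mem_ball, dist_eq_norm])
  filter_upwards [hmem] with y' hy'
  rw [mem_ball, dist_eq_norm] at hy'
  exact interp_eq_near h hy'

/-- Local form away from the lattice: if `|y − n| ≥ 1/2` for all `n`, the interpolant vanishes on `B(y, 1/4)`.
[cite: Federbush1986PhaseCellI, (4.5) p. 329] -/
theorem interp_eventuallyEq_zero (h : (Fin 4 → ℤ) → ℝ) {y : E4} (hy : ∀ n, 1 / 2 ≤ ‖y - latPt n‖) :
    interp h =ᶠ[nhds y] fun _ => 0 := by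
  filter_upwards [isOpen_ball.mem_nhds (mem_ball_self (by norm_num : (0 : ℝ) < 1 / 4))] with y' hy'
  rw [mem_ball, dist_eq_norm, norm_sub_rev] at hy'
  refine interp_eq_zero_of_far h fun n => ?_
  have := norm_sub_le_norm_sub_add_norm_sub y y' (latPt n)
  linarith [hy n]

/-- **`Λ ∈ C^∞(ℝ⁴)`.** [cite: Federbush1986PhaseCellI, (4.5) p. 329 («We now find Λ(x) in C^∞(R⁴)»)] -/
theorem contDiff_interp (h : (Fin 4 → ℤ) → ℝ) : ContDiff ℝ ∞ (interp h) := by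
  rw [contDiff_iff_contDiffAt]
  intro y
  by_cases hnear : ∃ n₀ : Fin 4 → ℤ, ‖y - latPt n₀‖ < 1 / 2
  · obtain ⟨n₀, hy⟩ := hnear
    have hφ : ContDiff ℝ ∞ fun y' : E4 => (bump : E4 → ℝ) (y' - latPt n₀) :=
      bump.contDiff.comp (contDiff_id.sub contDiff_const)
    have hsm : ContDiff ℝ ∞ fun y' : E4 => h n₀ • (bump : E4 → ℝ) (y' - latPt n₀) := hφ.const_smul (h n₀)
    exact hsm.contDiffAt.congr_of_eventuallyEq (interp_eventuallyEq_near h hy)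
  · have hfar : ∀ n, 1 / 2 ≤ ‖y - latPt n‖ := fun n => not_lt.1 fun hn => hnear ⟨n, hn⟩
    exact contDiffAt_const.congr_of_eventuallyEq (interp_eventuallyEq_zero h hfar)

/-- **(4.5)** `Λ(n) = h(n)` on `ℤ⁴`. [cite: Federbush1986PhaseCellI, (4.5) p. 329] -/
theorem interp_latPt (h : (Fin 4 → ℤ) → ℝ) (x : Fin 4 → ℤ) : interp h (latPt x) = h x := by
  rw [interp_eq_near h (n₀ := x) (by rw [sub_self, norm_zero]; norm_num), sub_self,
    bump.one_of_mem_closedBall (mem_closedBall_self bump.rIn_pos.le), smul_eq_mul, mul_one]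

/-! ## §3 The derivative bounds (4.6) -/

/-- Each derivative of the bump is bounded (continuous with compact support). [cite: Federbush1986PhaseCellI, (4.6) p. 329] -/
theorem exists_bound_iteratedFDeriv_bump (k : ℕ) : ∃ M : ℝ, 0 ≤ M ∧ ∀ z : E4, ‖iteratedFDeriv ℝ k (bump : E4 → ℝ) z‖ ≤ M := by
  obtain ⟨M, hM⟩ := ((bump.contDiff (n := k)).continuous_iteratedFDeriv le_rfl).bounded_above_of_compact_support
    (bump.hasCompactSupport.iteratedFDeriv k)
  exact ⟨M, (norm_nonneg _).trans (hM 0), hM⟩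

/-- **(4.6)** `‖D^kΛ(y)‖ ≤ ce^{γ/2}M_k e^{−γ|y|}` for `|h(n)| ≤ ce^{−γ|n|}` (`γ ≥ 0`, `M_k` a bound for `‖D^kφ‖`).
[cite: Federbush1986PhaseCellI, (4.6) p. 329] -/
theorem norm_iteratedFDeriv_interp_le {h : (Fin 4 → ℤ) → ℝ} {c γ : ℝ} (hγ : 0 ≤ γ)
    (hh : ∀ x, |h x| ≤ c * Real.exp (-γ * ‖latPt x‖)) (k : ℕ) {M : ℝ} (hM0 : 0 ≤ M)
    (hM : ∀ z : E4, ‖iteratedFDeriv ℝ k (bump : E4 → ℝ) z‖ ≤ M) (y : E4) :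
    ‖iteratedFDeriv ℝ k (interp h) y‖ ≤ c * Real.exp (γ / 2) * M * Real.exp (-γ * ‖y‖) := by
  have hc : 0 ≤ c := by
    have h0 := (abs_nonneg _).trans (hh 0)
    by_contra hc; rw [not_le] at hc
    linarith [mul_neg_of_neg_of_pos hc (Real.exp_pos (-γ * ‖latPt 0‖))]
  by_cases hnear : ∃ n₀ : Fin 4 → ℤ, ‖y - latPt n₀‖ < 1 / 2
  · obtain ⟨n₀, hy⟩ := hnear
    have hφ : ContDiff ℝ k fun y' : E4 => (bump : E4 → ℝ) (y' - latPt n₀) :=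
      bump.contDiff.comp (contDiff_id.sub contDiff_const)
    rw [((interp_eventuallyEq_near h hy).iteratedFDeriv ℝ k).eq_of_nhds,
      iteratedFDeriv_const_smul_apply' (a := h n₀) hφ.contDiffAt, iteratedFDeriv_comp_sub, norm_smul, Real.norm_eq_abs]
    have hexp : Real.exp (-γ * ‖latPt n₀‖) ≤ Real.exp (γ / 2) * Real.exp (-γ * ‖y‖) := by
      rw [← Real.exp_add]
      apply Real.exp_le_exp.2
      have : ‖y‖ ≤ ‖y - latPt n₀‖ + ‖latPt n₀‖ := norm_le_norm_sub_add y (latPt n₀)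
      nlinarith
    calc |h n₀| * ‖iteratedFDeriv ℝ k (bump : E4 → ℝ) (y - latPt n₀)‖ ≤ c * Real.exp (-γ * ‖latPt n₀‖) * M :=
          mul_le_mul (hh n₀) (hM _) (norm_nonneg _) (by positivity)
      _ ≤ c * (Real.exp (γ / 2) * Real.exp (-γ * ‖y‖)) * M := by gcongr
      _ = c * Real.exp (γ / 2) * M * Real.exp (-γ * ‖y‖) := by ring
  · have hfar : ∀ n, 1 / 2 ≤ ‖y - latPt n‖ := fun n => not_lt.1 fun hn => hnear ⟨n, hn⟩
    rw [((interp_eventuallyEq_zero h hfar).iteratedFDeriv ℝ k).eq_of_nhds, iteratedFDeriv_fun_zero, Pi.zero_apply,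
      norm_zero]
    positivity

/-- **(4.5)–(4.6) packaged.** «We now find Λ(x) in C^∞(R⁴) satisfying Λ(x) = h(x), x ∈ Z⁴, (4.5) and |D^αΛ(x)| < c_αe^{−γ|x|},
(4.6) as is trivial to accomplish» — for every lattice function with `|h(x)| ≤ ce^{−γ|x|}`, `γ ≥ 0`.
[cite: Federbush1986PhaseCellI, (4.5)–(4.6) p. 329] -/
theorem exists_smooth_interpolation {h : (Fin 4 → ℤ) → ℝ} {c γ : ℝ} (hγ : 0 ≤ γ)
    (hh : ∀ x, |h x| ≤ c * Real.exp (-γ * ‖latPt x‖)) :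
    ∃ Λ : E4 → ℝ, ContDiff ℝ ∞ Λ ∧ (∀ x, Λ (latPt x) = h x) ∧
      ∀ k : ℕ, ∃ C : ℝ, ∀ y : E4, ‖iteratedFDeriv ℝ k Λ y‖ ≤ C * Real.exp (-γ * ‖y‖) := by
  refine ⟨interp h, contDiff_interp h, interp_latPt h, fun k => ?_⟩
  obtain ⟨M, hM0, hM⟩ := exists_bound_iteratedFDeriv_bump k
  exact ⟨c * Real.exp (γ / 2) * M, norm_iteratedFDeriv_interp_le hγ hh k hM0 hM⟩

/-- **The `Λ` of (3.2) for a decaying bond function with zero plaquette values** ((4.3)–(4.6) combined): there are a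
lattice function `h` with `f = d₀h` and a smooth `Λ` with `Λ = h` on `ℤ⁴` and `‖D^kΛ(y)‖ ≤ C_k e^{−(γ/2)|y|}`.
[cite: Federbush1986PhaseCellI, (4.3)–(4.6) p. 329] -/
theorem exists_smooth_gauge_of_decay {f : Edge 0 → ℝ} {c γ : ℝ} (hγ : 0 < γ) (hf : DecayBound f c γ)
    (hcurl : ∀ p : Plaq 0, plaqOfBonds f p = 0) :
    ∃ (h : (Fin 4 → ℤ) → ℝ) (Λ : E4 → ℝ), (∀ e : Edge 0, f e = h (e.base + Pi.single e.dir 1) - h e.base) ∧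
      ContDiff ℝ ∞ Λ ∧ (∀ x, Λ (latPt x) = h x) ∧
      ∀ k : ℕ, ∃ C : ℝ, ∀ y : E4, ‖iteratedFDeriv ℝ k Λ y‖ ≤ C * Real.exp (-(γ / 2) * ‖y‖) := by
  obtain ⟨h, hbond, hdecay⟩ := exists_gaugeFn hγ hf hcurl
  obtain ⟨Λ, hΛ, hval, hder⟩ := exists_smooth_interpolation (h := h) (c := c * (1 - Real.exp (-(γ / 2)))⁻¹)
    (γ := γ / 2) (by positivity) (fun x => by simpa [latPt, neg_div] using hdecay x)
  exact ⟨h, Λ, hbond, hΛ, hval, fun k => by simpa [neg_div] using hder k⟩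

/-! ## §4 (4.2): the prescribed level-0 data decay trivially -/

/-- **(4.2)** «Clearly |A(e)| < ce^{−γd(e,0)}. (A(e) is zero almost everywhere.)»: level-0 data bounded by `|A(m)|` and
vanishing for bonds farther than `c₀` from the origin (the hypothesis of §0 p. 320 / (3.1) at level 0, `z = 0`) obey the
decay bound with constant `|A(m)|e^{γc₀}` (`γ ≥ 0`; READING `≤`). [cite: Federbush1986PhaseCellI, (4.2) p. 329; (3.1)
p. 327] -/
theorem decayBound_of_support {a : Edge 0 → ℝ} {c₀ Am γ : ℝ} (hγ : 0 ≤ γ)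
    (hsupp : ∀ e : Edge 0, c₀ < ‖e.src‖ → a e = 0) (hAm : ∀ e : Edge 0, |a e| ≤ Am) :
    DecayBound a (Am * Real.exp (γ * c₀)) γ := by
  intro e
  have hA0 : 0 ≤ Am := (abs_nonneg _).trans (hAm e)
  by_cases he : c₀ < ‖e.src‖
  · rw [hsupp e he, abs_zero]
    positivity
  · rw [not_lt] at he
    calc |a e| ≤ Am := hAm e
      _ = Am * Real.exp (γ * c₀) * Real.exp (-γ * c₀) := by
          rw [mul_assoc, ← Real.exp_add, show γ * c₀ + -γ * c₀ = 0 by ring, Real.exp_zero, mul_one]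
      _ ≤ Am * Real.exp (γ * c₀) * Real.exp (-γ * ‖e.src‖) := by
          refine mul_le_mul_of_nonneg_left (Real.exp_le_exp.2 ?_) (by positivity)
          nlinarith [mul_le_mul_of_nonneg_left he hγ]

end LatticeGauge

end

end Literature.MathematicalPhysics.QuantumFieldTheory.Federbush1986
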